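import Literature.Analysis.SpecialFunctions.LegendrePolynomials
import Literature.NumberTheory.LFunctions.WeilBlockRowsPZ
import HarnessLib

/-!
# Legendre coefficients: closed form, recurrences, and the kernel-cheap coefficient table

Purpose (GroundBarta / Weil-positivity block certificates, prover B g9 kernel-cost lever, RH-free): the Bessel-block claim rows
`Hp = C H Cᵀ` of a `WeilCert` (`WeilCert.checkHpRow`, Literature/NumberTheory/LFunctions/WeilBlockRowsPZ.lean) were verified numerically
row by row (`checkHpRowT`, ≈ 40 s of kernel time per row, 28 one-parity files per `nb = 136` certificate). Row `i` of `C` being the coefficient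
list of the Legendre polynomial `P_{2i+p}` in the powers `y^{2k+p}`, the claim IS Legendre orthogonality; these two files prove it once and
for all and replace the row files by ONE kernel identity `c.Cb p = legendreTable p nb` per parity.

This file: `legendreCoeffQ n j` (explicit rational coefficient of `X^j` in `P_n`, from Rodrigues: `coeff_legendre`), its factorial form,
the in-row ratio recurrence `legendreCoeffQ_step` (`c(n,j+2) = c(n,j)(j−n)(j+n+1)/((j+1)(j+2))`), the start values `legendreCoeffQ_start`
(`c(n+2,p) = −c(n,p)(n+1+p)/(n+2−p)`), and the table `legendreTable p N` generated by the two recurrences (no factorials, no binomials: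
evaluates in the kernel in seconds at `N = 136`) with `getM_legendreTable : getM (legendreTable p N) i k = legendreCoeffQ (2i+p) (2k+p)`.
Everything here is proved. [folklore]
-/

set_option linter.dupNamespace false

noncomputable section

open Polynomial Finset
open scoped Nat BigOperators

namespace Summit.RiemannHypothesis.RiemannHypothesis.Theorems.HpLegendre

open Literature.Analysis.SpecialFunctions Literature.NumberTheory.LFunctions

/-! ## The coefficients of `P_n` -/

/-- `W_n = (X² − 1)ⁿ` expanded binomially. [folklore] -/
theorem legendreW_eq_sum (n : ℕ) :
    legendreW n = ∑ m ∈ range (n + 1), C ((-1 : ℝ) ^ (n - m) * (n.choose m : ℝ)) * X ^ (2 * m) := by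
  unfold legendreW
  have h : (X : ℝ[X]) ^ 2 - 1 = X ^ 2 + C (-1 : ℝ) := by
    rw [map_neg, map_one, sub_eq_add_neg]
  rw [h, add_pow]
  refine Finset.sum_congr rfl fun m _ ↦ ?_
  rw [← pow_mul, ← C_pow, mul_comm 2 m]
  rw [show ((n.choose m : ℕ) : ℝ[X]) = C (n.choose m : ℝ) from (map_natCast C _).symm]
  rw [map_mul]
  ring

/-- The coefficients of `W_n`: `W_n.coeff j = [j even] (−1)^{n − j/2} C(n, j/2)`. [folklore] -/
theorem coeff_legendreW (n j : ℕ) :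
    (legendreW n).coeff j = if Even j then (-1 : ℝ) ^ (n - j / 2) * (n.choose (j / 2) : ℝ) else 0 := by
  rw [legendreW_eq_sum, finsetSum_coeff]
  simp only [coeff_C_mul_X_pow]
  by_cases hj : Even j
  · rw [if_pos hj]
    obtain ⟨k, rfl⟩ := hj
    have hk : (k + k) / 2 = k := by omega
    rw [hk]
    by_cases hkn : k ≤ n
    · rw [Finset.sum_eq_single k]
      · rw [if_pos (by ring)]
      · intro m _ hmk
        rw [if_neg]
        omega
      · intro hk'
        exact absurd (Finset.mem_range.2 (Nat.lt_succ_of_le hkn)) hk'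
    · rw [Finset.sum_eq_zero]
      · rw [Nat.choose_eq_zero_of_lt (not_le.1 hkn), Nat.cast_zero, mul_zero]
      · intro m hm
        rw [if_neg]
        have := Finset.mem_range.1 hm
        omega
  · rw [if_neg hj]
    refine Finset.sum_eq_zero fun m _ ↦ ?_
    rw [if_neg]
    rintro rfl
    exact hj ⟨m, by ring⟩

/-- The rational coefficient of `X^j` in the Legendre polynomial `P_n`:
`[j+n even] (−1)^{n − (j+n)/2} (j+n)^{(n)} C(n,(j+n)/2) / (2ⁿ n!)` (zero unless `j ≡ n (mod 2)` and `j ≤ n`). [folklore] -/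
def legendreCoeffQ (n j : ℕ) : ℚ :=
  if Even (j + n) then
    (-1 : ℚ) ^ (n - (j + n) / 2) * (((j + n).descFactorial n * n.choose ((j + n) / 2) : ℕ) : ℚ) / ((2 ^ n * n ! : ℕ) : ℚ)
  else 0

/-- **`(legendre n).coeff j = legendreCoeffQ n j`.** [folklore] -/
theorem coeff_legendre (n j : ℕ) : (legendre n).coeff j = (legendreCoeffQ n j : ℝ) := by
  unfold legendre legendreCoeffQ
  rw [coeff_C_mul, coeff_iterate_derivative_legendreW, coeff_legendreW]
  by_cases h : Even (j + n)
  · rw [if_pos h, if_pos h]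
    push_cast
    have h2 : (2 : ℝ) ^ n * (n ! : ℝ) ≠ 0 := by positivity
    field_simp
  · rw [if_neg h, if_neg h]
    simp

/-- Coefficients of the wrong parity vanish. [folklore] -/
theorem legendreCoeffQ_eq_zero_of_parity {n j : ℕ} (h : ¬ Even (j + n)) : legendreCoeffQ n j = 0 := by
  unfold legendreCoeffQ; rw [if_neg h]

/-- Sanity check by the kernel: `P₆ = (231 X⁶ − 315 X⁴ + 105 X² − 5)/16`. [folklore] -/
example : (List.range 7).map (legendreCoeffQ 6) = [-5/16, 0, 105/16, 0, -315/16, 0, 231/16] := by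
  decide +kernel

/-- factorial form: for `n ≤ 2m`, `m ≤ n`: `c(n, 2m − n) = (−1)^{n−m} (2m)! / ((2m−n)! m! (n−m)! 2^n)`. -/
theorem legendreCoeffQ_eq_factorial {n m : ℕ} (h1 : n ≤ 2 * m) (h2 : m ≤ n) :
    legendreCoeffQ n (2 * m - n) =
      (-1 : ℚ) ^ (n - m) * ((2 * m) ! : ℚ) / (((2 * m - n) ! : ℚ) * (m ! : ℚ) * ((n - m) ! : ℚ) * 2 ^ n) := by
  unfold legendreCoeffQ
  have hj : 2 * m - n + n = 2 * m := by omega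
  rw [hj, if_pos ⟨m, by ring⟩, show 2 * m / 2 = m by omega]
  -- descFactorial and choose in factorial form
  have hdf : ((2 * m - n) ! : ℚ) * ((2 * m).descFactorial n : ℚ) = ((2 * m) ! : ℚ) := by
    have := Nat.factorial_mul_descFactorial h1
    exact_mod_cast this
  have hch : (n.choose m : ℚ) * (m ! : ℚ) * ((n - m) ! : ℚ) = (n ! : ℚ) := by
    have := Nat.choose_mul_factorial_mul_factorial h2
    exact_mod_cast this
  have hf1 : ((2 * m - n) ! : ℚ) ≠ 0 := by positivity
  have hf2 : (m ! : ℚ) ≠ 0 := by positivity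
  have hf3 : ((n - m) ! : ℚ) ≠ 0 := by positivity
  have hf4 : (n ! : ℚ) ≠ 0 := by positivity
  have hdf' : ((2 * m).descFactorial n : ℚ) = ((2 * m) ! : ℚ) / ((2 * m - n) ! : ℚ) := by
    rw [eq_div_iff hf1, mul_comm]; exact hdf
  have hch' : (n.choose m : ℚ) = (n ! : ℚ) / ((m ! : ℚ) * ((n - m) ! : ℚ)) := by
    rw [eq_div_iff (mul_ne_zero hf2 hf3)]; rw [← hch]; ring
  push_cast
  rw [hdf', hch']
  field_simp

/-- zero beyond the degree -/
theorem legendreCoeffQ_eq_zero_of_lt {n j : ℕ} (h : n < j) : legendreCoeffQ n j = 0 := by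
  unfold legendreCoeffQ
  split_ifs with he
  · rw [Nat.choose_eq_zero_of_lt (by obtain ⟨m, hm⟩ := he; omega)]
    simp
  · rfl

/-- the in-row ratio recurrence: `c(n, j+2) = c(n, j) · (j − n)(j + n + 1) / ((j+1)(j+2))`. -/
theorem legendreCoeffQ_step (n j : ℕ) :
    legendreCoeffQ n (j + 2) = legendreCoeffQ n j * (((j : ℚ) - n) * ((j : ℚ) + n + 1)) / (((j : ℚ) + 1) * ((j : ℚ) + 2)) := by
  by_cases he : Even (j + n)
  · obtain ⟨m', hm'⟩ := he
    -- j + n = 2 m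
    have hm : j + n = 2 * m' := by omega
    by_cases hjn : j + 2 ≤ n ∨ n ≤ j
    · -- generic case via the factorial form at m and m+1
      rcases Nat.lt_or_ge n (j + 1) with hlt | hge
      · -- n ≤ j: then n < j+2 as well; both sides: c(n,j+2) = 0 and (if n < j) c(n,j) = 0, or n = j: factor (j - n) = 0
        rw [legendreCoeffQ_eq_zero_of_lt (by omega)]
        rcases Nat.lt_or_ge n j with h | h
        · rw [legendreCoeffQ_eq_zero_of_lt h]; ring
        · have : j = n := by omega
          subst this; ring
      · -- j + 2 ≤ n: m ≤ n - 1
        have h1 : n ≤ 2 * m' := by omega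
        have h2 : m' ≤ n := by omega
        have h2' : m' + 1 ≤ n := by omega
        have e1 : j = 2 * m' - n := by omega
        have e2 : j + 2 = 2 * (m' + 1) - n := by omega
        rw [e2, legendreCoeffQ_eq_factorial (by omega) h2', e1, legendreCoeffQ_eq_factorial h1 h2]
        -- factorial algebra, all in ℚ
        have F1 : ((2 * (m' + 1)) ! : ℚ) = (2 * m' + 2) * (2 * m' + 1) * ((2 * m') ! : ℚ) := by
          rw [show 2 * (m' + 1) = (2 * m' + 1) + 1 by ring, Nat.factorial_succ, Nat.factorial_succ (2 * m')]
          push_cast; ring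
        have F2 : ((2 * (m' + 1) - n) ! : ℚ) = ((2 * m' : ℚ) - n + 2) * ((2 * m' : ℚ) - n + 1) * ((2 * m' - n) ! : ℚ) := by
          rw [show 2 * (m' + 1) - n = (2 * m' - n + 1) + 1 by omega, Nat.factorial_succ, Nat.factorial_succ (2 * m' - n)]
          push_cast
          rw [Nat.cast_sub h1]; push_cast; ring
        have F3 : ((m' + 1) ! : ℚ) = ((m' : ℚ) + 1) * (m' ! : ℚ) := by
          rw [Nat.factorial_succ]; push_cast; ring
        have F4 : ((n - m') ! : ℚ) = ((n : ℚ) - m') * ((n - (m' + 1)) ! : ℚ) := by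
          rw [show n - m' = (n - (m' + 1)) + 1 by omega, Nat.factorial_succ]
          push_cast
          rw [Nat.cast_sub h2']; push_cast; ring
        have F5 : (-1 : ℚ) ^ (n - m') = -(-1 : ℚ) ^ (n - (m' + 1)) := by
          rw [show n - m' = (n - (m' + 1)) + 1 by omega, pow_succ]; ring
        have hq : ((2 * m' - n : ℕ) : ℚ) = 2 * (m' : ℚ) - n := by
          rw [Nat.cast_sub h1]; push_cast; ring
        rw [F1, F2, F3, F4, F5, hq]
        have hf1 : ((2 * m' - n) ! : ℚ) ≠ 0 := by positivity
        have hf2 : (m' ! : ℚ) ≠ 0 := by positivity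
        have hf3 : ((n - (m' + 1)) ! : ℚ) ≠ 0 := by positivity
        have hn1 : (2 * (m' : ℚ) - n + 1) ≠ 0 := by
          rw [← hq]; norm_cast
        have hn2 : (2 * (m' : ℚ) - n + 2) ≠ 0 := by
          rw [← hq]; norm_cast
        have hn3 : ((m' : ℚ) + 1) ≠ 0 := by positivity
        have hn4 : ((n : ℚ) - m') ≠ 0 := by
          rw [← Nat.cast_sub h2]; norm_cast; omega
        field_simp
        ring
    · push Not at hjn
      -- n = j + 1: parity impossible (j + n = 2j+1 odd)
      exfalso; omega
  · rw [legendreCoeffQ_eq_zero_of_parity he, legendreCoeffQ_eq_zero_of_parity (by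
      intro h2; apply he; obtain ⟨m, hm⟩ := h2; exact ⟨m - 1, by omega⟩)]
    ring


/-! ## start values `c(2i+p, p)` -/

/-- `c(2i+p, p)` by the recurrence `c(n+2, p) = −c(n, p)·(n+1+p)/(n+2−p)` (`n = 2i+p`): numerator `2i+2p+1`, denominator `2i+2`. -/
def legendreStart (p : ℕ) : ℕ → ℚ
  | 0 => 1
  | i + 1 => -(legendreStart p i * ((2 * i + 2 * p + 1 : ℕ) : ℚ) / ((2 * i + 2 : ℕ) : ℚ))

/-- **Start values**: `c(2i+p, p) = legendreStart p i` (`p ≤ 1`). [folklore] -/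
theorem legendreCoeffQ_start {p : ℕ} (hp : p ≤ 1) : ∀ i : ℕ, legendreCoeffQ (2 * i + p) p = legendreStart p i := by
  intro i
  induction i with
  | zero =>
    rcases Nat.le_one_iff_eq_zero_or_eq_one.1 hp with rfl | rfl <;> decide +kernel
  | succ i ih =>
    rw [legendreStart, ← ih]
    rcases Nat.le_one_iff_eq_zero_or_eq_one.1 hp with rfl | rfl
    · -- p = 0: n = 2i, m = i ; n' = 2i+2, m' = i+1
      have A := legendreCoeffQ_eq_factorial (n := 2 * i) (m := i) (by omega) (by omega)
      rw [show 2 * i - 2 * i = 0 by omega, show 2 * i - i = i by omega] at A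
      have B := legendreCoeffQ_eq_factorial (n := 2 * (i + 1)) (m := i + 1) (by omega) (by omega)
      rw [show 2 * (i + 1) - 2 * (i + 1) = 0 by omega, show 2 * (i + 1) - (i + 1) = i + 1 by omega] at B
      simp only [add_zero, mul_zero]
      rw [A, B]
      have F1 : ((2 * (i + 1)) ! : ℚ) = (2 * i + 2) * (2 * i + 1) * ((2 * i) ! : ℚ) := by
        rw [show 2 * (i + 1) = (2 * i + 1) + 1 by ring, Nat.factorial_succ, Nat.factorial_succ (2 * i)]
        push_cast; ring
      have F3 : ((i + 1) ! : ℚ) = ((i : ℚ) + 1) * (i ! : ℚ) := by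
        rw [Nat.factorial_succ]; push_cast; ring
      have F5 : (-1 : ℚ) ^ (i + 1) = -(-1 : ℚ) ^ i := by rw [pow_succ]; ring
      rw [F1, F3, F5, show 2 ^ (2 * (i + 1)) = (2 : ℚ) ^ (2 * i) * 4 by rw [show 2 * (i + 1) = 2 * i + 2 by ring, pow_add]; norm_num]
      have hf2 : (i ! : ℚ) ≠ 0 := by positivity
      have hf3 : ((2 * i) ! : ℚ) ≠ 0 := by positivity
      have hi1 : ((i : ℚ) + 1) ≠ 0 := by positivity
      push_cast
      field_simp
      ring
    · -- p = 1: n = 2i+1, m = i+1 (j = 1); n' = 2i+3, m' = i+2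
      have A := legendreCoeffQ_eq_factorial (n := 2 * i + 1) (m := i + 1) (by omega) (by omega)
      rw [show 2 * (i + 1) - (2 * i + 1) = 1 by omega, show 2 * i + 1 - (i + 1) = i by omega] at A
      have B := legendreCoeffQ_eq_factorial (n := 2 * (i + 1) + 1) (m := i + 2) (by omega) (by omega)
      rw [show 2 * (i + 2) - (2 * (i + 1) + 1) = 1 by omega, show 2 * (i + 1) + 1 - (i + 2) = i + 1 by omega] at B
      rw [A, B]
      have F1 : ((2 * (i + 2)) ! : ℚ) = (2 * i + 4) * (2 * i + 3) * ((2 * (i + 1)) ! : ℚ) := by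
        rw [show 2 * (i + 2) = (2 * (i + 1) + 1) + 1 by ring, Nat.factorial_succ, Nat.factorial_succ (2 * (i + 1))]
        push_cast; ring
      have F3 : ((i + 2) ! : ℚ) = ((i : ℚ) + 2) * ((i + 1) ! : ℚ) := by
        rw [show i + 2 = (i + 1) + 1 by ring, Nat.factorial_succ (i + 1)]; push_cast; ring
      have F4 : ((i + 1) ! : ℚ) = ((i : ℚ) + 1) * (i ! : ℚ) := by
        rw [Nat.factorial_succ]; push_cast; ring
      have F5 : (-1 : ℚ) ^ (i + 1) = -(-1 : ℚ) ^ i := by rw [pow_succ]; ring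
      rw [F1, F3, F4, F5, show (2 : ℚ) ^ (2 * (i + 1) + 1) = (2 : ℚ) ^ (2 * i + 1) * 4 by
        rw [show 2 * (i + 1) + 1 = (2 * i + 1) + 2 by ring, pow_add]; norm_num]
      have hf2 : (i ! : ℚ) ≠ 0 := by positivity
      have hf3 : ((2 * (i + 1)) ! : ℚ) ≠ 0 := by positivity
      have hi1 : ((i : ℚ) + 1) ≠ 0 := by positivity
      have hi2 : ((i : ℚ) + 2) ≠ 0 := by positivity
      simp only [Nat.factorial_one, Nat.cast_one, one_mul]
      push_cast
      field_simp
      ring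


/-! ## the coefficient table by the recurrences (kernel-cheap) -/

/-- `[a_j, a_{j+2}, …]` (`N` entries) generated from `a_j = a` by the in-row ratio recurrence of `P_n`. -/
def legendreRowFrom (n : ℕ) : ℕ → ℚ → ℕ → List ℚ
  | _, _, 0 => []
  | j, a, N + 1 => a :: legendreRowFrom n (j + 2) (a * (((j : ℚ) - n) * ((j : ℚ) + n + 1)) / (((j : ℚ) + 1) * ((j : ℚ) + 2))) N

/-- The generated row has the requested length. [folklore] -/
theorem length_legendreRowFrom (n : ℕ) : ∀ (N j : ℕ) (a : ℚ), (legendreRowFrom n j a N).length = N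
  | 0, _, _ => rfl
  | N + 1, j, a => by rw [legendreRowFrom, List.length_cons, length_legendreRowFrom n N]

/-- Entries of the generated row started at `c(n, j)`: entry `k` is `c(n, j + 2k)`. [folklore] -/
theorem getD_legendreRowFrom (n : ℕ) : ∀ (N j k : ℕ), k < N →
    (legendreRowFrom n j (legendreCoeffQ n j) N).getD k 0 = legendreCoeffQ n (j + 2 * k)
  | 0, _, _, h => absurd h (Nat.not_lt_zero _)
  | N + 1, j, 0, _ => by rw [legendreRowFrom, List.getD_cons_zero, mul_zero, add_zero]
  | N + 1, j, k + 1, h => by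
      rw [legendreRowFrom, List.getD_cons_succ, ← legendreCoeffQ_step n j,
        getD_legendreRowFrom n N (j + 2) k (by omega), show j + 2 + 2 * k = j + 2 * (k + 1) by ring]

/-- Row `i < N` = the coefficients of `P_{2i+p}` at the exponents `p, p+2, …, p+2i` (`i+1` entries). -/
def legendreTable (p N : ℕ) : List (List ℚ) :=
  (List.range N).map fun i ↦ legendreRowFrom (2 * i + p) p (legendreStart p i) (i + 1)

/-- **Entries of the table**: `(legendreTable p N)_{ik} = c(2i+p, 2k+p)` for `i < N` (zero beyond the triangle). [folklore] -/
theorem getM_legendreTable {p : ℕ} (hp : p ≤ 1) {N i : ℕ} (hi : i < N) (k : ℕ) :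
    getM (legendreTable p N) i k = legendreCoeffQ (2 * i + p) (2 * k + p) := by
  unfold getM legendreTable
  have hrow : ((List.range N).map fun i ↦ legendreRowFrom (2 * i + p) p (legendreStart p i) (i + 1)).getD i []
      = legendreRowFrom (2 * i + p) p (legendreStart p i) (i + 1) := by
    rw [List.getD_eq_getElem?_getD, List.getElem?_map, List.getElem?_range hi, Option.map_some, Option.getD_some]
  rw [hrow, ← legendreCoeffQ_start hp i]
  by_cases hk : k < i + 1
  · rw [getD_legendreRowFrom _ _ _ _ hk, show p + 2 * k = 2 * k + p by ring]
  · rw [List.getD_eq_default _ _ (by rw [length_legendreRowFrom]; omega),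
      legendreCoeffQ_eq_zero_of_lt (by omega)]

/-- kernel sanity check: the first rows of the even table are `P₀, P₂, P₄, P₆` in powers of `y²`. -/
example : legendreTable 0 4 = [[1], [-1/2, 3/2], [3/8, -30/8, 35/8], [-5/16, 105/16, -315/16, 231/16]] := by
  decide +kernel

/-- kernel sanity check: odd table `P₁, P₃, P₅`. -/
example : legendreTable 1 3 = [[1], [-3/2, 5/2], [15/8, -70/8, 63/8]] := by
  decide +kernel

end Summit.RiemannHypothesis.RiemannHypothesis.Theorems.HpLegendre

-- A g19 build note (2026-08-24T14:34Z): comment-only re-land, declarations byte-identical — R14-3 APPEND REMEDY to re-enqueue the hub build of this module (accepted, never built: dispatcher dead-lettered it during the 2026-08-24 lean-root outage).
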